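import Summits.Ventures.WeilGRH.UniformConductorFloorMinorant
import Summits.Ventures.WeilGRH.UniformConductorFloorCells
import HarnessLib

/-!
# GRH arm (rh-explicit, venture WeilGRH): slab lemmas for the joint cell certificate

Cell `rh-explicit`, WEIL TRACK — GRH ARM (weil-grh-1).  Helper inequalities for `UniformConductorFloorJointCells.lean`
(see its module docstring for the mathematics): for a test function `g` supported in `[-t, t]`, `h = |g|`,
`c_h(u) = ∫ h(y)h(y − u) dy`, a positive step vector `φ` on the `J` cells of width `δ = 2t/J`:

* `integral_norm_mul_norm_shift_add` — `c_h` is even;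
* `integrable_layer_integrand` — `u ↦ e^{−2l|u|}(‖g‖₂² − c_h(u))` is integrable on `ℝ`;
* `slab_ge` — on the slab `kδ ≤ u ≤ (k+1)δ`, for a weight `w ≥ 0`:
  `(∫_{slab} w)(‖g‖₂² − ½∫V_k|g|²) ≤ ∫_{slab} w(u)(‖g‖₂² − c_h(u)) du` (the one-shift AM–GM inequality
  `UniformFloor.two_mul_integral_le_of_phi` with shift index `s = k`);
* `layer_ge_two_mul` — `2∫_a^b ≤ ∫_ℝ` for the (even, non-negative) layer integrand, `0 ≤ a ≤ b`;
* `integral_eq_sum_slabs` — `∫_{k0δ}^{Kδ} = Σ_{k0≤k<K} ∫_{kδ}^{(k+1)δ}`.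

Everything is PROVED; no definitions; no named facts. [folklore]

## References

* L. Collatz (1942) / H. Wielandt (1950), the quotient bound for non-negative operators; A. Beurling, J. Deny (1958)
  (contractions lower Dirichlet forms). [folklore]
-/

noncomputable section

open Complex Filter Set MeasureTheory
open scoped Real Topology ComplexConjugate ArithmeticFunction.vonMangoldt

namespace Summit.Ventures.WeilGRH

open Literature.NumberTheory.LFunctions

namespace UniformFloor

variable {g : ℝ → ℂ}

/-! ## The autocorrelation of `|g|` is even; the layer integrand is non-negative and integrable -/

/-- `c_{|g|}(−u) = c_{|g|}(u)`: `∫ |g(y)||g(y + u)| dy = ∫ |g(y)||g(y − u)| dy` (translate `y ↦ y − u`). [folklore] -/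
theorem integral_norm_mul_norm_shift_add (g : ℝ → ℂ) (u : ℝ) :
    ∫ y : ℝ, ‖g y‖ * ‖g (y + u)‖ = ∫ y : ℝ, ‖g y‖ * ‖g (y - u)‖ := by
  have h := integral_sub_right_eq_self (μ := volume) (fun y : ℝ ↦ ‖g y‖ * ‖g (y + u)‖) u
  rw [← h]
  refine integral_congr_ae (Eventually.of_forall fun y ↦ ?_)
  simp only [sub_add_cancel]
  ring

/-- The layer integrand `e^{−2l|u|}(‖g‖₂² − c_{|g|}(u))` is integrable on `ℝ` (dominated by `e^{−2l|u|}‖g‖₂²`). [folklore] -/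
theorem integrable_layer_integrand (hg : IsWeilTest g) {l : ℝ} (hl : 0 < l) :
    Integrable fun u : ℝ ↦ Real.exp (-(2 * l * |u|)) * (weilNorm2Sq g - ∫ y : ℝ, ‖g y‖ * ‖g (y - u)‖) := by
  have hFnn : ∀ u, 0 ≤ weilNorm2Sq g - ∫ y : ℝ, ‖g y‖ * ‖g (y - u)‖ := fun u ↦
    sub_nonneg.2 (integral_norm_mul_norm_shift_le hg u)
  have hFle : ∀ u, weilNorm2Sq g - ∫ y : ℝ, ‖g y‖ * ‖g (y - u)‖ ≤ weilNorm2Sq g := fun u ↦ by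
    linarith [integral_norm_mul_norm_shift_nonneg g u]
  have hFm : Measurable fun u : ℝ ↦ weilNorm2Sq g - ∫ y : ℝ, ‖g y‖ * ‖g (y - u)‖ :=
    measurable_const.sub (stronglyMeasurable_integral_norm_mul_norm_shift hg).measurable
  have hEc : Continuous fun u : ℝ ↦ Real.exp (-(2 * l * |u|)) :=
    Real.continuous_exp.comp ((continuous_const.mul continuous_abs).neg)
  refine ((integrable_exp_neg_mul_abs (by positivity : 0 < 2 * l)).mul_const (weilNorm2Sq g)).mono'
    (hEc.measurable.mul hFm).aestronglyMeasurable (Eventually.of_forall fun u ↦ ?_)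
  rw [Real.norm_of_nonneg (mul_nonneg (Real.exp_pos _).le (hFnn u))]
  exact mul_le_mul_of_nonneg_left (hFle u) (Real.exp_pos _).le

/-! ## One slab -/

/-- **SLAB LEMMA.**  With the cell data of `two_mul_integral_le_of_phi` (`δ = 2t/J`), a slab index `k` and a weight `w ≥ 0`
interval-integrable on `[kδ, (k+1)δ]`: `(∫_{kδ}^{(k+1)δ} w)·(‖g‖₂² − ½∫V_k|g|²) ≤ ∫_{kδ}^{(k+1)δ} w(u)(‖g‖₂² − c_{|g|}(u)) du`,
because on the slab `2c_{|g|}(u) ≤ ∫ V_k |g|²` (one shift, `s = k`). [folklore] -/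
theorem slab_ge (hg : IsWeilTest g) {t : ℝ} (ht : 0 < t) (hsupp : tsupport g ⊆ Icc (-t) t) {J : ℕ} (hJ : 0 < J)
    (φ : ℤ → ℝ) {Φ₀ Φ₁ : ℝ} (hΦ₀ : 0 < Φ₀) (hφlo : ∀ i, 0 ≤ i → i < (J : ℤ) → Φ₀ ≤ φ i) (hφhi : ∀ i, φ i ≤ Φ₁)
    (hφout : ∀ i, i < 0 ∨ (J : ℤ) ≤ i → φ i = 0) (k : ℕ) {w : ℝ → ℝ}
    (hw0 : ∀ u ∈ Icc ((k : ℝ) * (2 * t / J)) (((k : ℝ) + 1) * (2 * t / J)), 0 ≤ w u)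
    (hwi : IntervalIntegrable w volume ((k : ℝ) * (2 * t / J)) (((k : ℝ) + 1) * (2 * t / J)))
    (hwF : IntervalIntegrable (fun u ↦ w u * (weilNorm2Sq g - ∫ y : ℝ, ‖g y‖ * ‖g (y - u)‖)) volume
      ((k : ℝ) * (2 * t / J)) (((k : ℝ) + 1) * (2 * t / J))) :
    (∫ u in ((k : ℝ) * (2 * t / J))..(((k : ℝ) + 1) * (2 * t / J)), w u) *
        (weilNorm2Sq g - 1 / 2 * ∫ x : ℝ,
          (max (φ (⌊(x + t) / (2 * t / J)⌋ - k - 1)) (φ (⌊(x + t) / (2 * t / J)⌋ - k)) +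
              max (φ (⌊(x + t) / (2 * t / J)⌋ + k)) (φ (⌊(x + t) / (2 * t / J)⌋ + k + 1))) /
            φ ⌊(x + t) / (2 * t / J)⌋ * ‖g x‖ ^ 2) ≤
      ∫ u in ((k : ℝ) * (2 * t / J))..(((k : ℝ) + 1) * (2 * t / J)),
        w u * (weilNorm2Sq g - ∫ y : ℝ, ‖g y‖ * ‖g (y - u)‖) := by
  set δ : ℝ := 2 * t / J with hδdef
  have hδ : 0 < δ := by positivity
  set X : ℝ := ∫ x : ℝ, (max (φ (⌊(x + t) / δ⌋ - k - 1)) (φ (⌊(x + t) / δ⌋ - k)) +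
      max (φ (⌊(x + t) / δ⌋ + k)) (φ (⌊(x + t) / δ⌋ + k + 1))) / φ ⌊(x + t) / δ⌋ * ‖g x‖ ^ 2 with hX
  have hab : (k : ℝ) * δ ≤ ((k : ℝ) + 1) * δ := by nlinarith
  -- on the slab, `c(u) ≤ X/2`
  have hcu : ∀ u ∈ Icc ((k : ℝ) * δ) (((k : ℝ) + 1) * δ), ∫ y : ℝ, ‖g y‖ * ‖g (y - u)‖ ≤ 1 / 2 * X := by
    intro u hu
    have h2 := two_mul_integral_le_of_phi hg ht hsupp hJ φ hΦ₀ hφlo hφhi hφout (L := u) (s := (k : ℤ))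
      (by positivity) (by have h1 := hu.1; push_cast; exact h1) (by have h1 := hu.2; push_cast; exact h1)
    rw [← hδdef] at h2
    have : 2 * ∫ y : ℝ, ‖g y‖ * ‖g (y - u)‖ ≤ X := by simpa only [hX] using h2
    linarith
  rw [← intervalIntegral.integral_mul_const]
  refine intervalIntegral.integral_mono_on hab (hwi.mul_const _) hwF fun u hu ↦ ?_
  exact mul_le_mul_of_nonneg_left (by linarith [hcu u hu]) (hw0 u hu)

/-! ## One layer: the whole line dominates twice the positive half-window, cut into slabs -/

/-- **LAYER ≥ SLABS.**  For `l > 0` and `0 ≤ a ≤ b`: `2∫_a^b e^{−2lu}(‖g‖₂² − c(u)) du ≤ ∫_ℝ e^{−2l|u|}(‖g‖₂² − c(u)) du`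
(the integrand is non-negative and even). [folklore] -/
theorem layer_ge_two_mul (hg : IsWeilTest g) {l : ℝ} (hl : 0 < l) {a b : ℝ} (ha : 0 ≤ a) (hab : a ≤ b) :
    2 * ∫ u in a..b, Real.exp (-(2 * l * |u|)) * (weilNorm2Sq g - ∫ y : ℝ, ‖g y‖ * ‖g (y - u)‖) ≤
      ∫ u : ℝ, Real.exp (-(2 * l * |u|)) * (weilNorm2Sq g - ∫ y : ℝ, ‖g y‖ * ‖g (y - u)‖) := by
  set f : ℝ → ℝ := fun u ↦ Real.exp (-(2 * l * |u|)) * (weilNorm2Sq g - ∫ y : ℝ, ‖g y‖ * ‖g (y - u)‖) with hf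
  have hfI : Integrable f := integrable_layer_integrand hg hl
  have hf0 : ∀ u, 0 ≤ f u := fun u ↦
    mul_nonneg (Real.exp_pos _).le (sub_nonneg.2 (integral_norm_mul_norm_shift_le hg u))
  have hfeven : ∀ u, f (-u) = f u := by
    intro u
    simp only [hf, abs_neg, sub_neg_eq_add, integral_norm_mul_norm_shift_add]
  -- the two half-slabs are disjoint
  have hdisj : Disjoint (Ioc a b) (Ioc (-b) (-a)) := by
    rw [Set.disjoint_left]
    intro x hx hx'
    have h1 := hx.1
    have h2 := hx'.2
    linarith
  have hS : ∫ u in Ioc a b ∪ Ioc (-b) (-a), f u = (∫ u in Ioc a b, f u) + ∫ u in Ioc (-b) (-a), f u :=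
    setIntegral_union hdisj measurableSet_Ioc hfI.integrableOn hfI.integrableOn
  have hle : ∫ u in Ioc a b ∪ Ioc (-b) (-a), f u ≤ ∫ u, f u :=
    setIntegral_le_integral hfI (Eventually.of_forall hf0)
  have h1 : ∫ u in Ioc a b, f u = ∫ u in a..b, f u := (intervalIntegral.integral_of_le hab).symm
  have h2 : ∫ u in Ioc (-b) (-a), f u = ∫ u in a..b, f u := by
    rw [← intervalIntegral.integral_of_le (neg_le_neg hab), ← intervalIntegral.integral_comp_neg]
    exact intervalIntegral.integral_congr fun u _ ↦ hfeven u
  rw [hS, h1, h2] at hle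
  linarith

/-- Splitting `[k0 δ, K δ]` into the slabs `[kδ, (k+1)δ]`, `k0 ≤ k < K`, for an integrand integrable on `ℝ`. [folklore] -/
theorem integral_eq_sum_slabs {f : ℝ → ℝ} (hfI : Integrable f) {δ : ℝ} {k0 K : ℕ} (hk : k0 ≤ K) :
    ∫ u in ((k0 : ℝ) * δ)..((K : ℝ) * δ), f u = ∑ k ∈ Finset.Ico k0 K, ∫ u in ((k : ℝ) * δ)..(((k : ℝ) + 1) * δ), f u := by
  have h := intervalIntegral.sum_integral_adjacent_intervals_Ico (a := fun k : ℕ ↦ (k : ℝ) * δ) (f := f) (μ := volume)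
    hk fun k _ ↦ hfI.intervalIntegrable
  simp only [Nat.cast_add, Nat.cast_one] at h
  exact h.symm

end UniformFloor

end Summit.Ventures.WeilGRH

end
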